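import Mathlib
import HarnessLib
import Summits.MatrixMultiplication.MatrixMultiplication.Theorems.OutsiderSandwichToricCeilingPowTwoCwBaseCensusA
import Summits.MatrixMultiplication.MatrixMultiplication.Theorems.OutsiderSandwichToricCeilingPowTwoCwBaseCensusB
import Summits.MatrixMultiplication.MatrixMultiplication.Theorems.OutsiderSandwichToricCeilingPowTwoCwBaseCensusC
import Summits.MatrixMultiplication.MatrixMultiplication.Theorems.OutsiderSandwichToricCeilingPowTwoCwBaseCensusD
import Summits.MatrixMultiplication.MatrixMultiplication.Theorems.OutsiderSandwichToricCeilingPowTransport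
import Summits.MatrixMultiplication.MatrixMultiplication.Theorems.OutsiderSandwichToricCeilingPowTwoCw

/-!
# OutsiderSandwich — toric ceiling of `cw₂^{⊠N}`: the `N = 3` TWO-CW BASE CENSUS (assembly) and the
UNCONDITIONAL ceiling `#Ψ ≤ 3^N − 3` for every basis with at most two cw coordinates, `N ≥ 4`
(decomp-mm lens 4, gen 47, kernel K47-6/K47-7; THESES-FREE, `ω`-free; helper toward `LaserTangency`,
stmt-32268 — the extremal subrank/packing cells of the literal host `kroneckerPow (cwTensor ℂ 2) N`)

LABEL.  TORIC · finite base (`N = 3`, kernel-decided) + uniform conclusion (`N ≥ 4`) · NEC-side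
instrument.  The rates, the crux `h₁ = LaserTangency` and the route's `closes` are untouched; the
root is the typed Statement `ω ℂ = 2`.

WHAT.  `twoCwBaseThree` = the hypothesis `hB₃'` of
`…PowTwoCw.productFrame_atMostTwoCw_no_diagonal_comb_degeneration_sub_two`, now a THEOREM: for every
basis `κ : Fin 3 → Bool` with exactly two cw coordinates, every LAWFUL co-size-2 complement
(`…PowMixedRules.lawκ` at every coordinate) of the product frame `frame κ` over `Word 3` has a
perfect matching (`…PowMixedGlue.isPMκ`).  PROOF = BRIDGE + CENSUS + SYMMETRY: `isPMκ_of_valid`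
turns a coded row list accepted by the Boolean checker `…TwoCwBaseDefs.valid` into an `isPMκ`
witness; the 3 510 certificates of `…TwoCwBaseDataA–D` are checked in the kernel
(`…TwoCwBaseCensusA–D`, in chunks of ≤ 150 resp. whole groups; `census_all`); an arbitrary lawful instance of `κ₀ = (cw, cw, D)` is carried
to an enumerated one by the 48-element symmetry group (`…TwoCwBaseDefs.exists_canon`, realised on
words by `φg` via `…PowTransport.relabW/permW`, frame- and law-preserving: `map3_φg_symm_mem`,
`law_φg`), by re-orienting pairs (`Finset.pair_comm`, `lawκ_swap_*`) and by the leg exchange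
(`…PowTransport.exists_isPMκ_swapYZ`); the arrangements `(cw, D, cw)`, `(D, cw, cw)` follow by
`…PowTransport.exists_isPMκ_perm`.  COROLLARY (K47-7)
`productFrame_atMostTwoCw_no_diagonal_comb_degeneration_sub_two'`: NO diagonal comb degeneration
`Ψ ⊴ frame κ` with `#Ψ ≥ 3^N − 2` exists for ANY basis `κ : Fin N → Bool` with at most two cw
coordinates and ANY `N ≥ 4` — unconditionally.  No new axioms (`propext`, `Classical.choice`,
`Quot.sound`); kernel `decide` only in the imported census files.
-/

set_option linter.dupNamespace false

namespace Summit.MatrixMultiplication.MatrixMultiplication.Theorems.OutsiderSandwichToricCeilingPowTwoCwBase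

open Finset
open Summit.MatrixMultiplication.MatrixMultiplication.Theorems.OutsiderSandwichToricCeilingPowFibres
  (Word Tr3 slotB frame)
open Summit.MatrixMultiplication.MatrixMultiplication.Theorems.OutsiderSandwichToricCeilingPowMixedGlue
open Summit.MatrixMultiplication.MatrixMultiplication.Theorems.OutsiderSandwichToricCeilingPowMixedRules
open Summit.MatrixMultiplication.MatrixMultiplication.Theorems.OutsiderSandwichToricCeilingPowTransport
open Summit.MatrixMultiplication.MatrixMultiplication.Theorems.OutsiderSandwichToricCeilingPowTwoCwBaseDefs
open Summit.MatrixMultiplication.MatrixMultiplication.Theorems.OutsiderSandwichToricCeilingPowTwoCwBaseCensusA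
  (len0 cover0 len1 cover1 len2 cover2)
open Summit.MatrixMultiplication.MatrixMultiplication.Theorems.OutsiderSandwichToricCeilingPowTwoCwBaseCensusB
  (len3 cover3 len4 cover4 len5 cover5)
open Summit.MatrixMultiplication.MatrixMultiplication.Theorems.OutsiderSandwichToricCeilingPowTwoCwBaseCensusC
  (len6 cover6 len7 cover7 len8 cover8)
open Summit.MatrixMultiplication.MatrixMultiplication.Theorems.OutsiderSandwichToricCeilingPowTwoCwBaseCensusD
  (census9 census10 census11)
open Summit.MatrixMultiplication.MatrixMultiplication.Theorems.OutsiderSandwichToricCeilingPowTwoCw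
  (productFrame_atMostTwoCw_no_diagonal_comb_degeneration_sub_two)

/-! ## §1 The bridge: from the Boolean checker to `isPMκ` -/

/-- A checked coded row decodes to a row of `frame κ₀`. -/
theorem dec3_mem_frame {t : T₃} (ht : rowOK t = true) : dec3 t ∈ frame κ₀ := by
  simp only [rowOK, Bool.and_eq_true] at ht
  rw [mem_frame]
  intro i
  fin_cases i
  · exact ht.1.1
  · exact ht.1.2
  · exact ht.2

/-- A leg of the decoded rows is injective when the coded legs are pairwise distinct. -/
theorem injOn_leg {M : List T₃} {f : T₃ → W₃} {g : Tr3 3 → Word 3} (hfg : ∀ t, g (dec3 t) = dec (f t))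
    (hn : (M.map f).Nodup) : Set.InjOn g ↑(M.map dec3).toFinset := by
  intro u hu u' hu' e
  simp only [List.coe_toFinset, Set.mem_setOf_eq, List.mem_map] at hu hu'
  obtain ⟨s, hs, rfl⟩ := hu
  obtain ⟨s', hs', rfl⟩ := hu'
  rw [hfg, hfg] at e
  rw [List.inj_on_of_nodup_map hn hs hs' (dec_injective e)]

/-- There are 27 words of length `3`. -/
theorem card_word_three : Fintype.card (Word 3) = 27 := by simp

/-- A leg image of the decoded rows is the complement of the removed pair. -/
theorem image_leg {M : List T₃} {f : T₃ → W₃} {g : Tr3 3 → Word 3} (hfg : ∀ t, g (dec3 t) = dec (f t))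
    (hn : (M.map f).Nodup) (hlen : M.length = 25) {x₁ x₂ : Word 3} (hx : x₁ ≠ x₂)
    (havoid : ∀ t ∈ M, f t ≠ enc x₁ ∧ f t ≠ enc x₂) :
    (M.map dec3).toFinset.image g = univ \ {x₁, x₂} := by
  apply Finset.eq_of_subset_of_card_le
  · intro w hw
    rw [Finset.mem_image] at hw
    obtain ⟨u, hu, rfl⟩ := hw
    rw [List.mem_toFinset, List.mem_map] at hu
    obtain ⟨s, hs, rfl⟩ := hu
    rw [hfg, Finset.mem_sdiff, Finset.mem_insert, Finset.mem_singleton]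
    refine ⟨Finset.mem_univ _, ?_⟩
    rintro (h | h)
    · exact (havoid s hs).1 (by rw [← enc_dec (f s), h])
    · exact (havoid s hs).2 (by rw [← enc_dec (f s), h])
  · have himg : (M.map dec3).toFinset.image g = ((M.map f).map dec).toFinset := by
      ext w
      rw [Finset.mem_image, List.mem_toFinset, List.mem_map]
      constructor
      · rintro ⟨u, hu, rfl⟩
        rw [List.mem_toFinset, List.mem_map] at hu
        obtain ⟨s, hs, rfl⟩ := hu
        exact ⟨f s, List.mem_map.2 ⟨s, hs, rfl⟩, (hfg s).symm⟩
      · rintro ⟨a, ha, rfl⟩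
        rw [List.mem_map] at ha
        obtain ⟨s, hs, rfl⟩ := ha
        exact ⟨dec3 s, List.mem_toFinset.2 (List.mem_map.2 ⟨s, hs, rfl⟩), hfg s⟩
    rw [Finset.card_univ_sdiff, Finset.card_pair hx, card_word_three, himg,
      List.toFinset_card_of_nodup (hn.map dec_injective), List.length_map, List.length_map, hlen]

/-- **BRIDGE.**  A list accepted by the checker decodes to a perfect matching (`isPMκ`) of
`frame κ₀` minus the three pairs of words. -/
theorem isPMκ_of_valid {x₁ x₂ y₁ y₂ z₁ z₂ : Word 3} (hx : x₁ ≠ x₂) (hy : y₁ ≠ y₂) (hz : z₁ ≠ z₂)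
    {M : List T₃} (hv : valid (enc x₁, enc x₂) (enc y₁, enc y₂) (enc z₁, enc z₂) M = true) :
    isPMκ κ₀ (M.map dec3).toFinset {x₁, x₂} {y₁, y₂} {z₁, z₂} = true := by
  simp only [valid, Bool.and_eq_true, List.all_eq_true, decide_eq_true_eq] at hv
  obtain ⟨hrow, hn₁, hn₂, hn₃, hlen⟩ := hv
  refine isPMκ_iff.2 ⟨?_, injOn_leg (f := fun t => t.1) (fun _ => rfl) hn₁,
    injOn_leg (f := fun t => t.2.1) (fun _ => rfl) hn₂,
    injOn_leg (f := fun t => t.2.2) (fun _ => rfl) hn₃,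
    image_leg (f := fun t => t.1) (fun _ => rfl) hn₁ hlen hx
      fun t ht => ⟨(hrow t ht).2.1, (hrow t ht).2.2.1⟩,
    image_leg (f := fun t => t.2.1) (fun _ => rfl) hn₂ hlen hy
      fun t ht => ⟨(hrow t ht).2.2.2.1, (hrow t ht).2.2.2.2.1⟩,
    image_leg (f := fun t => t.2.2) (fun _ => rfl) hn₃ hlen hz
      fun t ht => ⟨(hrow t ht).2.2.2.2.2.1, (hrow t ht).2.2.2.2.2.2⟩⟩
  intro u hu
  rw [List.mem_toFinset, List.mem_map] at hu
  obtain ⟨s, hs, rfl⟩ := hu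
  exact dec3_mem_frame (hrow s hs).1

/-! ## §2 Extraction of a certificate for a lawful instance -/

/-- Lawful letter quadruples are enumerated by `compl`. -/
theorem mem_compl {q : Bool} {a b c d e f : Fin 3} (h : lawκ q a b c d e f = true) :
    (c, d, e, f) ∈ compl q a b :=
  List.mem_filter.2 ⟨mem_allQ _, h⟩

/-- A lawful admissible instance with `x`-pair in `Xs` is enumerated by `instOf Xs`. -/
theorem mem_instOf {Xs : List (W₃ × W₃)} {x₁ x₂ y₁ y₂ z₁ z₂ : Word 3} (hX : (enc x₁, enc x₂) ∈ Xs)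
    (hadm : admissible ((enc x₁, enc x₂), (enc y₁, enc y₂), (enc z₁, enc z₂)) = true)
    (hlaw : ∀ i, lawκ (κ₀ i) (x₁ i) (x₂ i) (y₁ i) (y₂ i) (z₁ i) (z₂ i) = true) :
    ((enc x₁, enc x₂), (enc y₁, enc y₂), (enc z₁, enc z₂)) ∈ instOf Xs := by
  unfold instOf
  refine List.mem_flatMap.2 ⟨_, hX, List.mem_flatMap.2 ⟨(y₁ 0, y₂ 0, z₁ 0, z₂ 0), mem_compl (hlaw 0),
    List.mem_flatMap.2 ⟨(y₁ 1, y₂ 1, z₁ 1, z₂ 1), mem_compl (hlaw 1),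
    List.mem_filterMap.2 ⟨(y₁ 2, y₂ 2, z₁ 2, z₂ 2), mem_compl (hlaw 2), ?_⟩⟩⟩⟩
  have e : mkI (enc x₁, enc x₂) (y₁ 0, y₂ 0, z₁ 0, z₂ 0) (y₁ 1, y₂ 1, z₁ 1, z₂ 1)
      (y₁ 2, y₂ 2, z₁ 2, z₂ 2) = ((enc x₁, enc x₂), (enc y₁, enc y₂), (enc z₁, enc z₂)) := rfl
  simp only [e, hadm, if_true]

/-- An enumerated instance of a checked group has a valid certificate. -/
theorem exists_goodD_of_check {Xs : List (W₃ × W₃)} {ds : List ℕ} (h : check Xs ds = true) {I : I₃}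
    (hI : I ∈ instOf Xs) : ∃ n, goodD I n = true := by
  simp only [check, Bool.and_eq_true, decide_eq_true_eq, List.all_eq_true] at h
  obtain ⟨hlen, hall⟩ := h
  obtain ⟨i, hi, rfl⟩ := List.getElem_of_mem hI
  have hz : i < ((instOf Xs).zip ds).length := by rw [List.length_zip]; omega
  refine ⟨ds[i], hall ((instOf Xs)[i], ds[i]) ?_⟩
  have hm := List.getElem_mem hz
  rwa [List.getElem_zip] at hm

/-- An enumerated instance of a group checked IN CHUNKS has a valid certificate. -/
theorem exists_goodD_of_chunks {Xs : List (W₃ × W₃)} {ds : List ℕ}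
    (hlen : (instOf Xs).length = ds.length)
    (hcov : ∀ i < ds.length, ∃ lo n, lo ≤ i ∧ i < lo + n ∧
      ((((instOf Xs).zip ds).drop lo).take n).all (fun p => goodD p.1 p.2) = true)
    {I : I₃} (hI : I ∈ instOf Xs) : ∃ n, goodD I n = true := by
  obtain ⟨i, hi, rfl⟩ := List.getElem_of_mem hI
  obtain ⟨lo, n, hlo, hin, hall⟩ := hcov i (hlen ▸ hi)
  rw [List.all_eq_true] at hall
  obtain ⟨j, rfl⟩ := Nat.exists_eq_add_of_le hlo
  have h1 : j < ((((instOf Xs).zip ds).drop lo).take n).length := by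
    simp only [List.length_take, List.length_drop, List.length_zip]; omega
  have hm := List.getElem_mem h1
  rw [List.getElem_take, List.getElem_drop, List.getElem_zip] at hm
  exact ⟨_, hall _ hm⟩

/-- THE CENSUS, assembled from `…TwoCwBaseCensusA–D`: every enumerated instance of every canonical
`x`-pair has a valid certificate. -/
theorem census_all : ∀ X ∈ canonX, ∃ Xs, X ∈ Xs ∧ ∀ I ∈ instOf Xs, ∃ n, goodD I n = true := by
  intro X hX
  rw [canonX_eq] at hX
  simp only [List.mem_append] at hX
  rcases hX with h | h | h | h | h | h | h | h | h | h | h | h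
  exacts [⟨_, h, fun _ hI => exists_goodD_of_chunks len0 cover0 hI⟩,
    ⟨_, h, fun _ hI => exists_goodD_of_chunks len1 cover1 hI⟩,
    ⟨_, h, fun _ hI => exists_goodD_of_chunks len2 cover2 hI⟩,
    ⟨_, h, fun _ hI => exists_goodD_of_chunks len3 cover3 hI⟩,
    ⟨_, h, fun _ hI => exists_goodD_of_chunks len4 cover4 hI⟩,
    ⟨_, h, fun _ hI => exists_goodD_of_chunks len5 cover5 hI⟩,
    ⟨_, h, fun _ hI => exists_goodD_of_chunks len6 cover6 hI⟩,
    ⟨_, h, fun _ hI => exists_goodD_of_chunks len7 cover7 hI⟩,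
    ⟨_, h, fun _ hI => exists_goodD_of_chunks len8 cover8 hI⟩,
    ⟨_, h, fun _ hI => exists_goodD_of_check census9 hI⟩,
    ⟨_, h, fun _ hI => exists_goodD_of_check census10 hI⟩,
    ⟨_, h, fun _ hI => exists_goodD_of_check census11 hI⟩]

/-! ## §3 Order bookkeeping -/

/-- `wcode` is injective. -/
theorem wcode_inj : ∀ u v : W₃, wcode u = wcode v → u = v := by decide +kernel

/-- Increasingly coded words are distinct. -/
theorem ne_of_lt {u v : Word 3} (h : ltW (enc u) (enc v) = true) : u ≠ v := by
  rintro rfl; simp [ltW] at h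

/-- Distinct words have distinct codes. -/
theorem enc_ne {x₁ x₂ : Word 3} (hx : x₁ ≠ x₂) : enc x₁ ≠ enc x₂ :=
  fun e => hx (by rw [← dec_enc x₁, ← dec_enc x₂, e])

/-- Of two distinct words one is coded first. -/
theorem ltW_swap {x₁ x₂ : Word 3} (hx : x₁ ≠ x₂) (h : ¬ ltW (enc x₁) (enc x₂) = true) :
    ltW (enc x₂) (enc x₁) = true := by
  have hne : wcode (enc x₁) ≠ wcode (enc x₂) := fun e => enc_ne hx (wcode_inj _ _ e)
  simp only [ltW, decide_eq_true_eq] at h ⊢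
  omega

/-- `leP` is total. -/
theorem leP_total (Y Z : W₃ × W₃) : leP Y Z = true ∨ leP Z Y = true := by
  simp only [leP, decide_eq_true_eq]; omega

/-! ## §4 The symmetry group acting on words -/

/-- The letter part of a group element, as coordinatewise permutations. [new] -/
def τg (g : G₃) : Fin 3 → Equiv.Perm (Fin 3) := ![Lperm g.1, Lperm g.2.1, Dperm g.2.2.1]

/-- The coordinate part of a group element. [new] -/
def σg (g : G₃) : Equiv.Perm (Fin 3) := if g.2.2.2 then Equiv.swap 0 1 else 1

/-- The action on words, as a bijection (`…PowTransport`). [new] -/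
def φg (g : G₃) : Word 3 ≃ Word 3 := (relabW (τg g)).trans (permW (σg g))

/-- Pointwise formula for `φg`. -/
theorem φg_apply (g : G₃) (w : Word 3) (i : Fin 3) : φg g w i = τg g (σg g i) (w (σg g i)) := rfl

/-- Pointwise formula for `(φg g)⁻¹`. -/
theorem φg_symm_apply (g : G₃) (w : Word 3) (i : Fin 3) :
    (φg g).symm w i = (τg g i).symm (w ((σg g).symm i)) := rfl

/-- The coordinate part preserves the basis `κ₀`. -/
theorem κ₀_σg (g : G₃) : ∀ i, κ₀ (σg g i) = κ₀ i := by
  rcases g with ⟨k₀, k₁, k, s⟩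
  cases s
  · change ∀ i, κ₀ ((1 : Equiv.Perm (Fin 3)) i) = κ₀ i; decide
  · change ∀ i, κ₀ ((Equiv.swap (0 : Fin 3) 1) i) = κ₀ i; decide

/-- So does its inverse. -/
theorem κ₀_σg_symm (g : G₃) : ∀ i, κ₀ ((σg g).symm i) = κ₀ i := by
  rcases g with ⟨k₀, k₁, k, s⟩
  cases s
  · change ∀ i, κ₀ ((1 : Equiv.Perm (Fin 3)).symm i) = κ₀ i; decide
  · change ∀ i, κ₀ ((Equiv.swap (0 : Fin 3) 1).symm i) = κ₀ i; decide

/-- The inverse letter maps preserve the slots of `κ₀`. -/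
theorem slot_τg_symm (g : G₃) : ∀ j (a b c : Fin 3), slotB (κ₀ j) a b c = true →
    slotB (κ₀ j) ((τg g j).symm a) ((τg g j).symm b) ((τg g j).symm c) = true := by
  intro j; fin_cases j
  · exact slot_Lmap g.1
  · exact slot_Lmap g.2.1
  · exact slot_Dinv g.2.2.1

/-- The letter maps preserve the letter law of `κ₀`. -/
theorem law_τg (g : G₃) : ∀ j (a b c d e f : Fin 3), lawκ (κ₀ j) (τg g j a) (τg g j b) (τg g j c)
    (τg g j d) (τg g j e) (τg g j f) = lawκ (κ₀ j) a b c d e f := by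
  intro j; fin_cases j
  · exact law_Lmap g.1
  · exact law_Lmap g.2.1
  · exact law_Dmap g.2.2.1

/-- The word action, read in codes, is `actW`. -/
theorem enc_φg (g : G₃) (w : Word 3) : enc (φg g w) = actW g (enc w) := by
  rcases g with ⟨k₀, k₁, k, s⟩
  cases s <;> rfl

/-- `(φg g)⁻¹` preserves the frame. -/
theorem map3_φg_symm_mem (g : G₃) {t : Tr3 3} (ht : t ∈ frame κ₀) :
    map3 (φg g).symm t ∈ frame κ₀ := by
  rw [mem_frame] at ht ⊢
  intro i
  rw [map3_fst, map3_snd_fst, map3_snd_snd, φg_symm_apply, φg_symm_apply, φg_symm_apply]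
  have h := ht ((σg g).symm i)
  rw [κ₀_σg_symm] at h
  exact slot_τg_symm g i _ _ _ h

/-- `φg g` preserves the letter law of `κ₀`. -/
theorem law_φg (g : G₃) {x₁ x₂ y₁ y₂ z₁ z₂ : Word 3}
    (hlaw : ∀ i, lawκ (κ₀ i) (x₁ i) (x₂ i) (y₁ i) (y₂ i) (z₁ i) (z₂ i) = true) :
    ∀ i, lawκ (κ₀ i) (φg g x₁ i) (φg g x₂ i) (φg g y₁ i) (φg g y₂ i) (φg g z₁ i) (φg g z₂ i)
      = true := by
  intro i
  simp only [φg_apply]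
  have h := law_τg g (σg g i) (x₁ (σg g i)) (x₂ (σg g i)) (y₁ (σg g i)) (y₂ (σg g i))
    (z₁ (σg g i)) (z₂ (σg g i))
  rw [κ₀_σg] at h
  rw [h, ← κ₀_σg g i]
  exact hlaw _

/-! ## §5 Assembly -/

/-- CORE: an enumerated lawful instance has a perfect matching. -/
theorem core {x₁ x₂ y₁ y₂ z₁ z₂ : Word 3} (hX : (enc x₁, enc x₂) ∈ canonX)
    (hadm : admissible ((enc x₁, enc x₂), (enc y₁, enc y₂), (enc z₁, enc z₂)) = true)
    (hlaw : ∀ i, lawκ (κ₀ i) (x₁ i) (x₂ i) (y₁ i) (y₂ i) (z₁ i) (z₂ i) = true) :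
    ∃ P, isPMκ κ₀ P {x₁, x₂} {y₁, y₂} {z₁, z₂} = true := by
  obtain ⟨Xs, hXs, hgood⟩ := census_all _ hX
  obtain ⟨n, hn⟩ := hgood _ (mem_instOf hXs hadm hlaw)
  have hadm' := hadm; simp only [admissible, Bool.and_eq_true] at hadm'
  exact ⟨_, isPMκ_of_valid (ne_of_lt (canonX_lt _ hX)) (ne_of_lt hadm'.1.1) (ne_of_lt hadm'.1.2) hn⟩

/-- CANONICAL CASE: a lawful instance with canonical `x`-pair has a perfect matching (pairs
re-oriented, legs exchanged as needed). -/
theorem canonical_case {x₁ x₂ y₁ y₂ z₁ z₂ : Word 3} (hX : (enc x₁, enc x₂) ∈ canonX) (hy : y₁ ≠ y₂)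
    (hz : z₁ ≠ z₂) (hlaw : ∀ i, lawκ (κ₀ i) (x₁ i) (x₂ i) (y₁ i) (y₂ i) (z₁ i) (z₂ i) = true) :
    ∃ P, isPMκ κ₀ P {x₁, x₂} {y₁, y₂} {z₁, z₂} = true := by
  wlog hyo : ltW (enc y₁) (enc y₂) = true generalizing y₁ y₂
  · rw [pair_comm y₁]
    exact this hy.symm (fun i => lawκ_swap_y _ _ _ _ _ _ _ (hlaw i)) (ltW_swap hy hyo)
  wlog hzo : ltW (enc z₁) (enc z₂) = true generalizing z₁ z₂
  · rw [pair_comm z₁]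
    exact this hz.symm (fun i => lawκ_swap_z _ _ _ _ _ _ _ (hlaw i)) (ltW_swap hz hzo)
  rcases leP_total (enc y₁, enc y₂) (enc z₁, enc z₂) with hle | hle
  · exact core hX (by simp only [admissible, hyo, hzo, hle, Bool.and_self]) hlaw
  · exact exists_isPMκ_swapYZ (core hX (by simp only [admissible, hyo, hzo, hle, Bool.and_self])
      fun i => lawκ_swap_yz _ _ _ _ _ _ _ (hlaw i))

/-- **THE `N = 3` CENSUS, frame `cw ⊠ cw ⊠ D`**: every lawful co-size-2 complement has a perfect
matching. -/
theorem ccdBase : ∀ x₁ x₂ y₁ y₂ z₁ z₂ : Word 3, x₁ ≠ x₂ → y₁ ≠ y₂ → z₁ ≠ z₂ →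
    (∀ i, lawκ (κ₀ i) (x₁ i) (x₂ i) (y₁ i) (y₂ i) (z₁ i) (z₂ i) = true) →
    ∃ P, isPMκ κ₀ P {x₁, x₂} {y₁, y₂} {z₁, z₂} = true := by
  intro x₁ x₂ y₁ y₂ z₁ z₂ hx hy hz hlaw
  obtain ⟨g, hg⟩ := exists_canon (enc x₁) (enc x₂) (enc_ne hx)
  rw [← enc_φg, ← enc_φg] at hg
  have hne : ∀ {u v : Word 3}, u ≠ v → φg g u ≠ φg g v := fun h e => h ((φg g).injective e)
  have hlaw' := law_φg g hlaw
  have key : ∃ P, isPMκ κ₀ P {φg g x₁, φg g x₂} {φg g y₁, φg g y₂} {φg g z₁, φg g z₂} = true := by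
    by_cases hxo : ltW (enc (φg g x₁)) (enc (φg g x₂)) = true
    · rw [sortP, if_pos hxo] at hg
      exact canonical_case hg (hne hy) (hne hz) hlaw'
    · rw [sortP, if_neg hxo] at hg
      rw [pair_comm (φg g x₁)]
      exact canonical_case hg (hne hy) (hne hz) fun i => lawκ_swap_x _ _ _ _ _ _ _ (hlaw' i)
  have h := exists_isPMκ_transport (κ := κ₀) (κ' := κ₀) (φg g).symm
    (fun t ht => map3_φg_symm_mem g ht) key
  simpa only [Equiv.symm_apply_apply] using h

/-- The three bases of `Fin 3` with exactly two cw coordinates. -/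
theorem kappa_two : ∀ κ : Fin 3 → Bool,
    (∀ i j k, κ i = true → κ j = true → κ k = true → i = j ∨ j = k ∨ i = k) →
    (∃ i j, i ≠ j ∧ κ i = true ∧ κ j = true) →
    κ = κ₀ ∨ κ = κ₀ ∘ ⇑(Equiv.swap (1 : Fin 3) 2) ∨ κ = κ₀ ∘ ⇑(Equiv.swap (0 : Fin 3) 2) := by
  decide

/-- **THE `N = 3` TWO-CW CENSUS FOR WORDS** (the hypothesis `hB₃'` of
`…PowTwoCw.productFrame_atMostTwoCw_no_diagonal_comb_degeneration_sub_two`, now a theorem): every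
lawful co-size-2 complement of a two-cw product frame over `Word 3` (frames `cw ⊠ cw ⊠ D`,
`cw ⊠ D ⊠ cw`, `D ⊠ cw ⊠ cw`) has a perfect matching.  [TORIC · finite (N = 3) · NEC-side
instrument; kernel-decided census + symmetry] -/
theorem twoCwBaseThree : ∀ κ : Fin 3 → Bool,
    (∀ i j k, κ i = true → κ j = true → κ k = true → i = j ∨ j = k ∨ i = k) →
    (∃ i j, i ≠ j ∧ κ i = true ∧ κ j = true) →
    ∀ x₁ x₂ y₁ y₂ z₁ z₂ : Word 3, x₁ ≠ x₂ → y₁ ≠ y₂ → z₁ ≠ z₂ →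
    (∀ i, lawκ (κ i) (x₁ i) (x₂ i) (y₁ i) (y₂ i) (z₁ i) (z₂ i) = true) →
    ∃ P, isPMκ κ P {x₁, x₂} {y₁, y₂} {z₁, z₂} = true := by
  intro κ hκ h2 x₁ x₂ y₁ y₂ z₁ z₂ hx hy hz hlaw
  rcases kappa_two κ hκ h2 with rfl | rfl | rfl
  · exact ccdBase _ _ _ _ _ _ hx hy hz hlaw
  · exact exists_isPMκ_perm _ ccdBase _ _ _ _ _ _ hx hy hz hlaw
  · exact exists_isPMκ_perm _ ccdBase _ _ _ _ _ _ hx hy hz hlaw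

/-! ## §6 Corollary: the unconditional two-cw ceiling -/

/-- **NO DIAGONAL COMB DEGENERATION OF SIZE `≥ 3^N − 2` IN A PRODUCT FRAME WITH AT MOST TWO CW
COORDINATES, `N ≥ 4` — UNCONDITIONAL** (K47-7 = K47-4 with its base hypothesis discharged by
`twoCwBaseThree`): for every `N ≥ 4`, every basis `κ : Fin N → Bool` with at most two cw
coordinates, and every `Ψ ⊆ frame κ` carrying a diagonal comb degeneration (weights `a, b, c` with
`a + b + c = 0` on `Ψ` and `≥ 1` on `frame κ ∖ Ψ`, distinct elements of `Ψ` sharing no leg),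
`#Ψ ≤ 3^N − 3`.  [TORIC · uniform in `N ≥ 4` · NEC-side instrument toward `LaserTangency`; the
crux and its rates are untouched] -/
theorem productFrame_atMostTwoCw_no_diagonal_comb_degeneration_sub_two' {R : Type*} [CommRing R]
    [LinearOrder R] [IsStrictOrderedRing R] {N : ℕ} (hN : 4 ≤ N) (κ : Fin N → Bool)
    (hκ : ∀ i j k, κ i = true → κ j = true → κ k = true → i = j ∨ j = k ∨ i = k)
    {Ψ : Finset (Tr3 N)} {a b c : Word N → R} (hsub : Ψ ⊆ frame κ)
    (hzero : ∀ t ∈ Ψ, a t.1 + b t.2.1 + c t.2.2 = 0)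
    (hone : ∀ t ∈ frame κ, t ∉ Ψ → 1 ≤ a t.1 + b t.2.1 + c t.2.2)
    (hdiag : ∀ t ∈ Ψ, ∀ t' ∈ Ψ, (t.1 = t'.1 ∨ t.2.1 = t'.2.1 ∨ t.2.2 = t'.2.2) → t = t')
    (hbig : 3 ^ N ≤ #Ψ + 2) : False :=
  productFrame_atMostTwoCw_no_diagonal_comb_degeneration_sub_two twoCwBaseThree hN κ hκ hsub hzero
    hone hdiag hbig

end Summit.MatrixMultiplication.MatrixMultiplication.Theorems.OutsiderSandwichToricCeilingPowTwoCwBase
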